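import Mathlib
import HarnessLib
import Summits.Ventures.LatticeQCDFlow.Scoring.KishESSBlockStatistics
import Summits.Ventures.LatticeQCDFlow.Exactness.RatioEstimator
import Literature.Probability.HeavyTails.StrongLawInfiniteMean

/-!
# The `ε = 0` rung of the moment ladder: the weight, partition-function and observable columns
# of ONE growing proposal stream are STRONGLY CONSISTENT under FIRST moments only — no second
# weight moment (the effective sample size may be `0`), no ceiling, no bound on the observable

HONEST FRAMING: exact (Metropolis-corrected) sampling algorithms for lattice gauge theory;
figures of merit are autocorrelation/cost numbers at stated couplings and volumes; no
continuum-physics claim.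

Venture `LatticeQCDFlow` (cell pub-lqcd), topic `Scoring`; FANOUT row 4 (`s0-u1-b`, rung S0-B:
two independent codes compared column by column).  Row 4's median-of-blocks files certify the
printed columns of a flow code at exponential confidence with RATES, along a MOMENT LADDER:
bounded reweighted observables and the printed acceptance ratio need a `(1 + ε)`-th model moment
of the weight (`Scoring/SelfNormalisedReweightingHeavyTail`, `…/AllPairsAcceptanceRatioHeavyTail`),
the ESS column a `(2 + 2ε)`-th (`Scoring/KishESSHeavyTail`), and `ε = 0` — consistency without a
rate — was left NOT CLAIMED.  This file is that bottom rung for the columns that are plain or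
self-normalised MEANS along one i.i.d. proposal stream `y₀, y₁, …` (laws `ν = q dμ`), with
UNNORMALISED weights `w̃ = c·w`, `w = p/q` (`c = Z` unknown):

* the mean weight `W̄ₙ = Σ_{i<n} w(yᵢ)/n → 1` and the printed mean unnormalised weight
  `Σ_{i<n} w̃(yᵢ)/n → c` (the partition-function column is consistent) — inputs `∫ p dμ = 1` only;
* the mean squared weight `F̄ₙ = Σ_{i<n} w(yᵢ)²/n → M₂ = ∫ p²/q dμ = 1/ESS` when `p²/q ∈ L¹(μ)`,
  and `F̄ₙ → +∞` almost surely when `p²/q ∉ L¹(μ)` (ESS `= 0`: Durrett's Theorem 2.4.5, imported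
  from `Literature/Probability/HeavyTails/StrongLawInfiniteMean`);
* the unnormalised reweighting mean `Êₙ = Σ_{i<n} w(yᵢ)O(yᵢ)/n → E_p O = ∫ p·O dμ` and the PRINTED
  self-normalised estimate `Sₙ = Σ w̃ᵢOᵢ / Σ w̃ᵢ → E_p O` for every SIGNED, UNBOUNDED observable
  with `p·O ∈ L¹(μ)` — nothing else (row 30's abstract ratio theorem
  `Exactness.ratio_estimator_consistent'` instantiated with the model dictionary).

Everything is "almost surely as `n → ∞`" along ONE stream on one probability space; the only
probabilistic input is Mathlib's strong law (`ProbabilityTheory.strong_law_ae_real`, Etemadi's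
pairwise-independent version).  The printed counterparts — consistency of self-normalised
importance sampling (Geweke, Econometrica 57 (1989) Thm 1; Owen, *Monte Carlo theory, methods and
examples* (2013) §9.2) — are NAMED ONLY; nothing is cited as a fact; NEW WORK of the cell
(elementary); no definition is introduced.  The `Fin n`-indexed sums of the block files and the
`range n` sums here agree (`Finset.sum_range`).

## Content (`ν = μ.withDensity q`; `w = p/q`; stream `y : ℕ → Ω → X`, independent, laws `ν`)

§1 dictionary for a stream read through a measurable statistic `g : X → ℝ`:
`identDistrib_stream`, `identDistrib_comp_stream`, `pairwise_indepFun_comp_stream`,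
`integral_comp_stream`, `integrable_comp_stream_iff`; **`strong_law_stream`**
(`g ∈ L¹(ν)` ⇒ `Σ_{i<n} g(yᵢ)/n → ∫ g dν` a.s.) and **`strong_law_stream_atTop`** (`g ≥ 0`,
`g ∉ L¹(ν)` ⇒ `→ +∞` a.s.).
§2 the columns: **`meanWeight_tendsto_one_ae`**, `unnormalisedMeanWeight_tendsto_ae`,
**`sqWeightMean_tendsto_ae`**, **`sqWeightMean_tendsto_atTop_ae`**, **`reweighting_tendsto_ae`**,
**`selfNormReweighting_tendsto_ae`**.

NOT CLAIMED: any rate (that is the ladder above `ε = 0`); the ESS and acceptance columns (next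
files); the chain-side (`τ_int`) column; any number of ours re-scored.
-/

noncomputable section

namespace Summit.Ventures.LatticeQCDFlow.Scoring.CardConsistency

open MeasureTheory ProbabilityTheory Finset Real Filter
open scoped Topology Function

/-! ## §1 An i.i.d. stream read through a statistic: dictionary and the strong law -/

section Stream

variable {Ω : Type*} [MeasurableSpace Ω] {P : Measure Ω}
variable {X : Type*} [MeasurableSpace X] {ν : Measure X} {y : ℕ → Ω → X}

/-- Two draws of a stream with a common law are identically distributed. [folklore] -/
theorem identDistrib_stream (hym : ∀ j, Measurable (y j)) (hlaw : ∀ j, Measure.map (y j) P = ν)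
    (i j : ℕ) : IdentDistrib (y i) (y j) P P where
  aemeasurable_fst := (hym i).aemeasurable
  aemeasurable_snd := (hym j).aemeasurable
  map_eq := by rw [hlaw, hlaw]

/-- A measurable statistic of the draws of a stream with a common law is identically distributed
along the stream. [folklore] -/
theorem identDistrib_comp_stream (hym : ∀ j, Measurable (y j))
    (hlaw : ∀ j, Measure.map (y j) P = ν) {g : X → ℝ} (hg : Measurable g) (i : ℕ) :
    IdentDistrib (fun ω => g (y i ω)) (fun ω => g (y 0 ω)) P P :=
  (identDistrib_stream hym hlaw i 0).comp hg

/-- A measurable statistic of the draws of an independent stream is pairwise independent along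
the stream. [folklore] -/
theorem pairwise_indepFun_comp_stream (hind : iIndepFun y P) {g : X → ℝ} (hg : Measurable g) :
    Pairwise ((· ⟂ᵢ[P] ·) on fun i ω => g (y i ω)) := fun _ _ hij =>
  (hind.indepFun hij).comp hg hg

/-- `E[g(yᵢ)] = ∫ g dν`. [folklore] -/
theorem integral_comp_stream (hym : ∀ j, Measurable (y j))
    (hlaw : ∀ j, Measure.map (y j) P = ν) {g : X → ℝ} (hg : Measurable g) (i : ℕ) :
    ∫ ω, g (y i ω) ∂P = ∫ a, g a ∂ν := by
  rw [← hlaw i, integral_map (hym i).aemeasurable hg.aestronglyMeasurable]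

/-- `g(yᵢ) ∈ L¹(P) ↔ g ∈ L¹(ν)`. [folklore] -/
theorem integrable_comp_stream_iff (hym : ∀ j, Measurable (y j))
    (hlaw : ∀ j, Measure.map (y j) P = ν) {g : X → ℝ} (hg : Measurable g) (i : ℕ) :
    Integrable (fun ω => g (y i ω)) P ↔ Integrable g ν := by
  rw [← hlaw i, integrable_map_measure hg.aestronglyMeasurable (hym i).aemeasurable]
  rfl

/-- **The strong law along the stream**: for an independent stream with common law `ν` and a
measurable `g ∈ L¹(ν)`, almost surely `Σ_{i<n} g(yᵢ)/n → ∫ g dν`. [ours] (Mathlib's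
`strong_law_ae_real` read through the dictionary) -/
theorem strong_law_stream (hym : ∀ j, Measurable (y j)) (hind : iIndepFun y P)
    (hlaw : ∀ j, Measure.map (y j) P = ν) {g : X → ℝ} (hg : Measurable g)
    (hgi : Integrable g ν) :
    ∀ᵐ ω ∂P, Tendsto (fun n : ℕ => (∑ i ∈ range n, g (y i ω)) / n) atTop (𝓝 (∫ a, g a ∂ν)) := by
  have h := strong_law_ae_real (μ := P) (fun i ω => g (y i ω))
    ((integrable_comp_stream_iff hym hlaw hg 0).2 hgi) (pairwise_indepFun_comp_stream hind hg)
    (identDistrib_comp_stream hym hlaw hg)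
  rw [← integral_comp_stream hym hlaw hg 0]
  exact h

/-- **The strong law along the stream with an infinite mean**: `g ≥ 0` measurable with
`g ∉ L¹(ν)` ⇒ almost surely `Σ_{i<n} g(yᵢ)/n → +∞`. [ours] (Durrett's Theorem 2.4.5,
`Literature.Probability.HeavyTails.strong_law_infinite_mean_of_nonneg`, read through the
dictionary) -/
theorem strong_law_stream_atTop [IsProbabilityMeasure P] (hym : ∀ j, Measurable (y j))
    (hind : iIndepFun y P)
    (hlaw : ∀ j, Measure.map (y j) P = ν) {g : X → ℝ} (hg : Measurable g) (hg0 : ∀ a, 0 ≤ g a)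
    (hgi : ¬ Integrable g ν) :
    ∀ᵐ ω ∂P, Tendsto (fun n : ℕ => (∑ i ∈ range n, g (y i ω)) / n) atTop atTop :=
  Literature.Probability.HeavyTails.strong_law_infinite_mean_of_nonneg (μ := P)
    (fun i ω => g (y i ω)) (pairwise_indepFun_comp_stream hind hg)
    (identDistrib_comp_stream hym hlaw hg) (fun _ _ => hg0 _)
    fun h => hgi ((integrable_comp_stream_iff hym hlaw hg 0).1 h)

end Stream

/-! ## §2 The weight, partition-function and observable columns of one proposal stream -/

section Model

variable {Ω : Type*} [MeasurableSpace Ω] {P : Measure Ω}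
variable {X : Type*} [MeasurableSpace X] {μ : Measure X} {p q O : X → ℝ} {y : ℕ → Ω → X}

/-- **The mean weight is strongly consistent**: `W̄ₙ = Σ_{i<n} w(yᵢ)/n → 1` almost surely, for a
normalised target (`∫ p dμ = 1`) and `q > 0`; no second moment (ESS may be `0`). [ours] -/
theorem meanWeight_tendsto_one_ae (hym : ∀ j, Measurable (y j)) (hind : iIndepFun y P)
    (hlaw : ∀ j, Measure.map (y j) P = μ.withDensity fun z => ENNReal.ofReal (q z))
    (hpm : Measurable p) (hpi : Integrable p μ) (hp1 : ∫ z, p z ∂μ = 1) (hq0 : ∀ z, 0 < q z)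
    (hqm : Measurable q) :
    ∀ᵐ ω ∂P, Tendsto (fun n : ℕ => (∑ i ∈ range n, p (y i ω) / q (y i ω)) / n) atTop (𝓝 1) := by
  have hw := AllPairsVariance.integral_weight_withDensity_eq (μ := μ) hpi hq0 hqm
  have hgm : Measurable fun a => p a / q a := hpm.div hqm
  have h := strong_law_stream hym hind hlaw (g := fun a => p a / q a) hgm hw.1
  rw [hw.2, hp1] at h
  exact h

/-- **The partition-function column is strongly consistent**: with weights printed as
`w̃ = c·p/q` (any real `c`, e.g. `c = Z`), `Σ_{i<n} w̃(yᵢ)/n → c` almost surely. [ours] -/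
theorem unnormalisedMeanWeight_tendsto_ae (hym : ∀ j, Measurable (y j)) (hind : iIndepFun y P)
    (hlaw : ∀ j, Measure.map (y j) P = μ.withDensity fun z => ENNReal.ofReal (q z))
    (hpm : Measurable p) (hpi : Integrable p μ) (hp1 : ∫ z, p z ∂μ = 1) (hq0 : ∀ z, 0 < q z)
    (hqm : Measurable q) {wt : X → ℝ} {c : ℝ} (hwt : ∀ z, wt z = c * (p z / q z)) :
    ∀ᵐ ω ∂P, Tendsto (fun n : ℕ => (∑ i ∈ range n, wt (y i ω)) / n) atTop (𝓝 c) := by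
  filter_upwards [meanWeight_tendsto_one_ae hym hind hlaw hpm hpi hp1 hq0 hqm] with ω hω
  have e : (fun n : ℕ => (∑ i ∈ range n, wt (y i ω)) / n)
      = fun n : ℕ => c * ((∑ i ∈ range n, p (y i ω) / q (y i ω)) / n) := by
    funext n
    simp_rw [hwt]
    rw [← Finset.mul_sum, mul_div_assoc]
  rw [e]
  simpa only [mul_one] using hω.const_mul c

/-- `w² ∈ L¹(q dμ) ↔ p²/q ∈ L¹(μ)` (`(p/q)²·q = p²/q`). [ours] -/
theorem integrable_sqWeight_model_iff (hpm : Measurable p) (hq0 : ∀ z, 0 < q z)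
    (hqm : Measurable q) :
    Integrable (fun a => (p a / q a) ^ 2) (μ.withDensity fun z => ENNReal.ofReal (q z))
      ↔ Integrable (fun z => p z ^ 2 / q z) μ := by
  rw [AllPairsVariance.integrable_withDensity_iff' (fun z => (hq0 z).le) hqm]
  have e : (fun a => (p a / q a) ^ 2 * q a) = fun a => p a ^ 2 / q a := by
    funext a
    field_simp [(hq0 a).ne']
  have _ := hpm
  rw [e]

/-- **The mean squared weight is strongly consistent for `M₂ = 1/ESS`**: if `p²/q ∈ L¹(μ)` then
`F̄ₙ = Σ_{i<n} w(yᵢ)²/n → M₂ = ∫ p²/q dμ` almost surely. [ours] -/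
theorem sqWeightMean_tendsto_ae (hym : ∀ j, Measurable (y j)) (hind : iIndepFun y P)
    (hlaw : ∀ j, Measure.map (y j) P = μ.withDensity fun z => ENNReal.ofReal (q z))
    (hpm : Measurable p) (hq0 : ∀ z, 0 < q z) (hqm : Measurable q)
    (hM2i : Integrable (fun z => p z ^ 2 / q z) μ) :
    ∀ᵐ ω ∂P, Tendsto (fun n : ℕ => (∑ i ∈ range n, (p (y i ω) / q (y i ω)) ^ 2) / n) atTop
      (𝓝 (∫ z, p z ^ 2 / q z ∂μ)) := by
  have hgm : Measurable fun a => (p a / q a) ^ 2 := (hpm.div hqm).pow_const 2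
  have h := strong_law_stream hym hind hlaw (g := fun a => (p a / q a) ^ 2) hgm
    ((integrable_sqWeight_model_iff hpm hq0 hqm).2 hM2i)
  rw [AllPairsMedian.integral_sq_weight_model hq0 hqm] at h
  exact h

/-- **ESS `= 0`: the mean squared weight diverges**: if `p²/q ∉ L¹(μ)` then
`F̄ₙ = Σ_{i<n} w(yᵢ)²/n → +∞` almost surely (a finite-depth printed `F̄` has no finite limit to
estimate). [ours] -/
theorem sqWeightMean_tendsto_atTop_ae [IsProbabilityMeasure P] (hym : ∀ j, Measurable (y j))
    (hind : iIndepFun y P)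
    (hlaw : ∀ j, Measure.map (y j) P = μ.withDensity fun z => ENNReal.ofReal (q z))
    (hpm : Measurable p) (hq0 : ∀ z, 0 < q z) (hqm : Measurable q)
    (hM2i : ¬ Integrable (fun z => p z ^ 2 / q z) μ) :
    ∀ᵐ ω ∂P, Tendsto (fun n : ℕ => (∑ i ∈ range n, (p (y i ω) / q (y i ω)) ^ 2) / n) atTop
      atTop := by
  have hgm : Measurable fun a => (p a / q a) ^ 2 := (hpm.div hqm).pow_const 2
  exact strong_law_stream_atTop hym hind hlaw (g := fun a => (p a / q a) ^ 2) hgm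
    (fun _ => sq_nonneg _) fun h => hM2i ((integrable_sqWeight_model_iff hpm hq0 hqm).1 h)

/-- `w·O ∈ L¹(q dμ) ↔ p·O ∈ L¹(μ)` (`(p/q)·O·q = p·O`). [ours] -/
theorem integrable_weightMul_model_iff (hpm : Measurable p) (hq0 : ∀ z, 0 < q z)
    (hqm : Measurable q) :
    Integrable (fun a => p a / q a * O a) (μ.withDensity fun z => ENNReal.ofReal (q z))
      ↔ Integrable (fun z => p z * O z) μ := by
  rw [AllPairsVariance.integrable_withDensity_iff' (fun z => (hq0 z).le) hqm]
  have e : (fun a => p a / q a * O a * q a) = fun a => p a * O a := by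
    funext a
    field_simp [(hq0 a).ne']
  have _ := hpm
  rw [e]

/-- **The unnormalised reweighting mean is strongly consistent** for every SIGNED, UNBOUNDED
observable with `p·O ∈ L¹(μ)`: `Êₙ = Σ_{i<n} w(yᵢ)O(yᵢ)/n → E_p O = ∫ p·O dμ` almost surely;
no second moment. [ours] -/
theorem reweighting_tendsto_ae (hym : ∀ j, Measurable (y j)) (hind : iIndepFun y P)
    (hlaw : ∀ j, Measure.map (y j) P = μ.withDensity fun z => ENNReal.ofReal (q z))
    (hpm : Measurable p) (hq0 : ∀ z, 0 < q z) (hqm : Measurable q) (hOm : Measurable O)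
    (hpO : Integrable (fun z => p z * O z) μ) :
    ∀ᵐ ω ∂P, Tendsto (fun n : ℕ => (∑ i ∈ range n, p (y i ω) / q (y i ω) * O (y i ω)) / n)
      atTop (𝓝 (∫ z, p z * O z ∂μ)) := by
  have hgm : Measurable fun a => p a / q a * O a := (hpm.div hqm).mul hOm
  have h := strong_law_stream hym hind hlaw (g := fun a => p a / q a * O a) hgm
    ((integrable_weightMul_model_iff hpm hq0 hqm).2 hpO)
  rw [ReweightingMedian.integral_weightMul_model hq0 hqm] at h
  exact h

/-- **THE PRINTED SELF-NORMALISED REWEIGHTING ESTIMATE IS STRONGLY CONSISTENT.**  One independent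
proposal stream `yᵢ` (laws `μ.withDensity q`); `p` measurable, integrable, `∫ p dμ = 1`; `q > 0`
measurable; `O` measurable with `p·O ∈ L¹(μ)` (signed, unbounded); weights printed with ANY
normalisation `w̃ = c·p/q`, `c ≠ 0`.  Then almost surely
`Sₙ = Σ_{i<n} w̃(yᵢ)O(yᵢ) / Σ_{i<n} w̃(yᵢ) → ∫ p·O dμ` — no second weight moment (ESS may be `0`),
no ceiling, no bound on `O`. [ours] (row 30's `Exactness.ratio_estimator_consistent'` with the
model dictionary: `E[w̃O] = c·E_p O`, `E[w̃] = c`) -/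
theorem selfNormReweighting_tendsto_ae (hym : ∀ j, Measurable (y j)) (hind : iIndepFun y P)
    (hlaw : ∀ j, Measure.map (y j) P = μ.withDensity fun z => ENNReal.ofReal (q z))
    (hpm : Measurable p) (hpi : Integrable p μ) (hp1 : ∫ z, p z ∂μ = 1) (hq0 : ∀ z, 0 < q z)
    (hqm : Measurable q) (hOm : Measurable O) (hpO : Integrable (fun z => p z * O z) μ)
    {wt : X → ℝ} {c : ℝ} (hc : c ≠ 0) (hwt : ∀ z, wt z = c * (p z / q z)) :
    ∀ᵐ ω ∂P, Tendsto (fun n : ℕ =>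
        (∑ i ∈ range n, wt (y i ω) * O (y i ω)) / (∑ i ∈ range n, wt (y i ω))) atTop
      (𝓝 (∫ z, p z * O z ∂μ)) := by
  have hwf : wt = fun z => c * (p z / q z) := funext hwt
  have hwtm : Measurable wt := by
    rw [hwf]
    exact (hpm.div hqm).const_mul c
  have hAm : Measurable fun a => wt a * O a := hwtm.mul hOm
  have hw := AllPairsVariance.integral_weight_withDensity_eq (μ := μ) hpi hq0 hqm
  -- `w̃ ∈ L¹(ν)`, `E_ν w̃ = c`
  have hBi : Integrable wt (μ.withDensity fun z => ENNReal.ofReal (q z)) := by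
    rw [hwf]
    exact hw.1.const_mul c
  have hBe : ∫ a, wt a ∂(μ.withDensity fun z => ENNReal.ofReal (q z)) = c := by
    rw [hwf, integral_const_mul, hw.2, hp1, mul_one]
  -- `w̃O ∈ L¹(ν)`, `E_ν w̃O = c·E_p O`
  have hAf : (fun a => wt a * O a) = fun a => c * (p a / q a * O a) := by
    funext a
    rw [hwt, mul_assoc]
  have hAi : Integrable (fun a => wt a * O a) (μ.withDensity fun z => ENNReal.ofReal (q z)) := by
    rw [hAf]
    exact ((integrable_weightMul_model_iff hpm hq0 hqm).2 hpO).const_mul c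
  have hAe : ∫ a, wt a * O a ∂(μ.withDensity fun z => ENNReal.ofReal (q z))
      = c * ∫ z, p z * O z ∂μ := by
    rw [hAf, integral_const_mul, ReweightingMedian.integral_weightMul_model hq0 hqm]
  refine Exactness.ratio_estimator_consistent' (μ := P) (fun i ω => wt (y i ω) * O (y i ω))
    (fun i ω => wt (y i ω))
    ((integrable_comp_stream_iff hym hlaw (g := fun a => wt a * O a) hAm 0).2 hAi)
    ((integrable_comp_stream_iff hym hlaw (g := wt) hwtm 0).2 hBi)
    (pairwise_indepFun_comp_stream hind (g := fun a => wt a * O a) hAm)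
    (pairwise_indepFun_comp_stream hind (g := wt) hwtm)
    (identDistrib_comp_stream hym hlaw (g := fun a => wt a * O a) hAm)
    (identDistrib_comp_stream hym hlaw (g := wt) hwtm) hc ?_ ?_
  · show ∫ ω, wt (y 0 ω) * O (y 0 ω) ∂P = c * ∫ z, p z * O z ∂μ
    rw [integral_comp_stream hym hlaw (g := fun a => wt a * O a) hAm 0, hAe]
  · show ∫ ω, wt (y 0 ω) ∂P = c
    rw [integral_comp_stream hym hlaw (g := wt) hwtm 0, hBe]

end Model

end Summit.Ventures.LatticeQCDFlow.Scoring.CardConsistency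

end
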